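import Summits.Ventures.HodgeRepro2.T5SU11OrbitMeasure
import Summits.Ventures.HodgeRepro2.T5SU11KProjection
import Summits.Ventures.HodgeRepro2.T5SU11BorelHaarRight

/-!
# The coordinate maps of `SU(1,1)` as measure-preserving maps; `(n_s a_t)·0` carries `e^{-2t} ds dt` to the Poincaré measure

The measure identities of the lane are packaged in Mathlib's `MeasurePreserving` vocabulary, so that
its transfer lemmas (`MeasurePreserving.integral_comp`, `lintegral_comp`, `integrable_comp`, …) apply
directly: the fibration `Φ : (𝔻, poincare) × (K, μ_K) → (G, ν)` (`measurePreserving_fib`), the Iwasawa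
map `Ψ : (ℂ, e^{-2t} ds dt) × (K, μ_K) → (G, ν)` (`measurePreserving_iwasawa`), the `N A` chart
`(ℂ, e^{-2t} ds dt) → (B, borelHaar)` (`measurePreserving_borelCoordNAB`) and the `A N` chart
`(ℂ, ds dt) → (B, borelHaar)` (`measurePreserving_borelCoordB`), the multiplication maps
`B × K → G` and `K × B → G` (`measurePreserving_mulBK`, `measurePreserving_mulKB`), the orbit map
`(G, ν) → (𝔻, μ_K(K) • poincare)` (`measurePreserving_orbit`), and — new — the Iwasawa
parametrisation of the disc `ζ = s + i t ↦ (n_s a_t)·0`: **`(iwasawaOrbit)_* (e^{-2t} ds dt) = poincare`**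
(`map_iwasawaOrbit_iwasawaDensity`, `measurePreserving_iwasawaOrbit`; from `orbit ∘ Ψ = iwasawaOrbit ∘ fst`
and `orbit_* ν = μ_K(K) • poincare` with the probability Haar measure of `K`), a measurable embedding
(`measurableEmbedding_iwasawaOrbit`). Nothing is claimed about (N).

Blind lane: Mathlib + the HodgeRepro2 prefix only; no sorry; axioms ⊆ {propext, Classical.choice,
Quot.sound}.
-/

namespace Summit.Ventures.HodgeRepro2.T5SU11MeasurePreserving

open MeasureTheory MeasureTheory.Measure Metric Set Filter Topology Complex
open T5PoincareDensity T5PoincareInvariance T5PoincareMeasure T5SU11Unimodular T5SU11Fibration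
  T5SU11FibrationHaar T5SU11Cartan T5SU11OneParameter T5BergmanCoefficient T5SU11FibrationCocycle
  T5SU11QuotientIntegral T5HaarCircle T5SU11CoefficientL2 T5SU11OrbitMeasure T5SU11IwasawaHaar
  T5SU11IwasawaMeasure T5SU11BorelHaar T5SU11BorelHaarMeasure T5SU11BorelHaarNA T5SU11HaarBK
  T5SU11BorelHaarRight T5SU11KProjection T5SU11UnipotentSubgroup T5SU11HyperbolicSubgroup
open scoped ENNReal NNReal Real

/-! ### The Iwasawa parametrisation of the disc -/

/-- `orbit ∘ Ψ = iwasawaOrbit ∘ fst`: the orbit point of `n_s a_t k` is `(n_s a_t)·0`. -/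
lemma orbit_comp_iwasawa : orbit ∘ iwasawa = iwasawaOrbit ∘ Prod.fst := by
  funext p
  exact orbit_iwasawa p.1 p.2

/-- `iwasawaOrbit` is continuous. -/
lemma continuous_iwasawaOrbit : Continuous iwasawaOrbit :=
  continuous_orbit.comp ((continuous_unip.comp Complex.continuous_re).mul
    (continuous_hyp.comp Complex.continuous_im))

/-- `iwasawaOrbit` is injective. -/
lemma iwasawaOrbit_injective : Function.Injective iwasawaOrbit := fun _ _ h =>
  iwasawaOrbit_injOn (Set.mem_univ _) (Set.mem_univ _) h

/-- `iwasawaOrbit` is a measurable embedding `ℂ → ℂ` (continuous and injective on a Polish space). -/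
lemma measurableEmbedding_iwasawaOrbit : MeasurableEmbedding iwasawaOrbit :=
  continuous_iwasawaOrbit.measurableEmbedding iwasawaOrbit_injective

/-- The `A N` chart `ζ ↦ a_t n_s` is measure preserving `(ds dt) → borelHaar`. -/
theorem measurePreserving_borelCoordB : MeasurePreserving borelCoordB volume borelHaar :=
  ⟨measurable_borelCoordB, rfl⟩

/-- The `N A` chart `ζ ↦ n_s a_t` is measure preserving `(e^{-2t} ds dt) → borelHaar`. -/
theorem measurePreserving_borelCoordNAB : MeasurePreserving borelCoordNAB iwasawaDensity borelHaar :=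
  ⟨measurable_borelCoordNAB, borelHaar_eq_map_NA.symm⟩

section measure

variable [MeasurableSpace Circle] [BorelSpace Circle]

/-- **`(n_s a_t)·0` carries `e^{-2t} ds dt` to the Poincaré measure**:
`(iwasawaOrbit)_* iwasawaDensity = poincare`. -/
theorem map_iwasawaOrbit_iwasawaDensity :
    Measure.map iwasawaOrbit iwasawaDensity = poincare := by
  have h := map_orbit_nu haarCircle
  rw [nu_eq_map_iwasawa, Measure.map_map continuous_orbit.measurable measurable_iwasawa,
    orbit_comp_iwasawa, ← Measure.map_map continuous_iwasawaOrbit.measurable measurable_fst,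
    Measure.map_fst_prod, haarCircle_univ, one_smul, one_smul] at h
  exact h

/-- `ζ ↦ (n_s a_t)·0` is measure preserving from `e^{-2t} ds dt` to `poincare`. -/
theorem measurePreserving_iwasawaOrbit : MeasurePreserving iwasawaOrbit iwasawaDensity poincare :=
  ⟨continuous_iwasawaOrbit.measurable, map_iwasawaOrbit_iwasawaDensity⟩

/-- `poincare E = ∫_{iwasawaOrbit⁻¹ E} e^{-2t} ds dt` for every set `E`. -/
theorem poincare_apply_iwasawa (E : Set ℂ) : poincare E = iwasawaDensity (iwasawaOrbit ⁻¹' E) := by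
  rw [← map_iwasawaOrbit_iwasawaDensity, measurableEmbedding_iwasawaOrbit.map_apply]

/-! ### The coordinate maps as measure-preserving maps -/

variable (μC : Measure Circle) [IsHaarMeasure μC]

omit [IsHaarMeasure μC] in
/-- The fibration `Φ(z, u) = s(z) rot u` is measure preserving `(poincare ⊗ μ_K) → ν`. -/
theorem measurePreserving_fib : MeasurePreserving fib (poincare.prod μC) (nu μC) :=
  ⟨measurable_fib, rfl⟩

/-- The Iwasawa map `Ψ(ζ, k) = n_s a_t k` is measure preserving `(e^{-2t} ds dt ⊗ μ_K) → ν`. -/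
theorem measurePreserving_iwasawa : MeasurePreserving iwasawa (iwasawaDensity.prod μC) (nu μC) :=
  ⟨measurable_iwasawa, (nu_eq_map_iwasawa μC).symm⟩

/-- The multiplication `B × K → G` is measure preserving `(borelHaar ⊗ μ_K) → ν`. -/
theorem measurePreserving_mulBK : MeasurePreserving mulBK (borelHaar.prod μC) (nu μC) :=
  ⟨measurable_mulBK, (nu_eq_map_mulBK μC).symm⟩

/-- The multiplication `K × B → G` is measure preserving `(μ_K ⊗ borelHaarRight) → ν`. -/
theorem measurePreserving_mulKB : MeasurePreserving mulKB (μC.prod borelHaarRight) (nu μC) :=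
  ⟨measurable_mulKB, (nu_eq_map_mulKB μC).symm⟩

/-- The orbit map `g ↦ g·0` is measure preserving `ν → μ_K(K) • poincare`. -/
theorem measurePreserving_orbit : MeasurePreserving orbit (nu μC) (μC Set.univ • poincare) :=
  ⟨continuous_orbit.measurable, map_orbit_nu μC⟩

/-- With the probability Haar measure of `K`, the orbit map is measure preserving `ν → poincare`. -/
theorem measurePreserving_orbit_haarCircle : MeasurePreserving orbit (nu haarCircle) poincare := by
  have h := measurePreserving_orbit haarCircle
  rwa [haarCircle_univ, one_smul] at h

/-- **`∫_𝔻 G dpoincare = ∫_ℂ G((n_s a_t)·0) d(e^{-2t} ds dt)`** for EVERY `G` (the measurable-embedding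
form of `T5SU11IwasawaHaar.integral_poincare`, with the density kept inside `iwasawaDensity`). -/
theorem integral_poincare_iwasawa' {E : Type*} [NormedAddCommGroup E] [NormedSpace ℝ E]
    (G : ℂ → E) : ∫ z, G z ∂poincare = ∫ ζ, G (iwasawaOrbit ζ) ∂iwasawaDensity := by
  rw [← map_iwasawaOrbit_iwasawaDensity, measurableEmbedding_iwasawaOrbit.integral_map]

end measure

end Summit.Ventures.HodgeRepro2.T5SU11MeasurePreserving
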